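import Summits.Schanuel.Schanuel.Theorems.ZilberEacMovingLineFast
import Mathlib.Analysis.SpecialFunctions.Pow.Deriv
import Mathlib.Analysis.SpecialFunctions.Complex.Arg
import HarnessLib

/-!
# The exponential–exponential balance: analytic lemmas

Zilber's Exponential-Algebraic Closedness, case ladder (host summit Schanuel, cell `pub-schanuel`,
seat 2, gen 8).  Lemmas for `ZilberEacExpExpBalance`: over a QUADRATIC graph base `x₁ = p(x₀)` the
equation `e^{z} = A(z) + e^{p(z)} F(e^{p(z)})` is solved (whatever the signs of the leading
coefficients — in particular in the "explosion" regime `Re p → +∞` along every lattice ray) by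
balancing the two EXPONENTIALS: `e^{z} ≈ lc(F) e^{(1 + deg F) p(z)}` with `Re z → +∞`, along a branch
`z(ζ)` of the quadratic equation `z - e p(z) - log lc(F) - ζ = 2πi k q` (generalising seat 2 gen 3's
diagonal escape `e^{z} = z + e^{-2z²}`).  Here:

* `sqrt_one_add_facts` — the principal square root `w = (1+η)^{1/2}` for `‖η‖ ≤ 1/2`: `1 + η` is in
  the slit plane, `w² = 1 + η`, `Re w > 0`, `‖w - 1‖ ≤ ‖η‖`;
* `exists_sign_sqrt` — for `α ≠ 0`, `e ≥ 1` a sign `q = ±1` and a square root `μ` of `-8π e α q i`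
  with `Re(μ/(2eα)) > 0` (the direction in which the branch escapes to `Re z = +∞`);
* `tendsto_sqrt_pow_mul_exp_neg` — `(√k)^d e^{-(ρ√k - C)} → 0`;
* `pow_pred_le_div_add` — the Young-type split `t^{e-1} ≤ t^e/T + T^{e-1}` (`t ≥ 0`, `T > 0`).

HONEST FRAMING: auxiliary analysis; nothing here bears on Schanuel's conjecture; EAC ⇏ SC.
-/

noncomputable section

open Complex Filter Topology Metric

set_option linter.dupNamespace false

namespace Summit.Schanuel.Schanuel.Theorems

/-- **The principal square root near `1`.**  For `‖η‖ ≤ 1/2`: `1 + η ∈ slitPlane`,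
`((1+η)^{1/2})² = 1 + η`, `Re (1+η)^{1/2} > 0`, and `‖(1+η)^{1/2} - 1‖ ≤ ‖η‖`
(from `(w - 1)(w + 1) = η` and `‖w + 1‖ ≥ Re w + 1 ≥ 1`). [folklore] -/
theorem sqrt_one_add_facts {η : ℂ} (hη : ‖η‖ ≤ 1 / 2) :
    (1 + η) ∈ slitPlane ∧ ((1 + η) ^ ((2 : ℂ)⁻¹)) ^ 2 = 1 + η ∧
      0 < ((1 + η) ^ ((2 : ℂ)⁻¹)).re ∧ ‖(1 + η) ^ ((2 : ℂ)⁻¹) - 1‖ ≤ ‖η‖ := by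
  set D : ℂ := 1 + η with hD
  have hDre : 0 < D.re := by
    rw [hD, Complex.add_re, Complex.one_re]
    have : |η.re| ≤ 1 / 2 := (Complex.abs_re_le_norm η).trans hη
    rw [abs_le] at this
    linarith
  have hslit : D ∈ slitPlane := mem_slitPlane_iff.2 (Or.inl hDre)
  have hD0 : D ≠ 0 := slitPlane_ne_zero hslit
  set w : ℂ := D ^ ((2 : ℂ)⁻¹) with hw
  have hsq : w ^ 2 = D := by
    have h := Complex.cpow_nat_inv_pow D (n := 2) two_ne_zero
    simp only [Nat.cast_ofNat] at h
    exact h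
  have hwre : 0 < w.re := by
    rw [hw, Complex.cpow_def_of_ne_zero hD0, Complex.exp_re]
    refine mul_pos (Real.exp_pos _) (Real.cos_pos_of_mem_Ioo ?_)
    have harg1 : Complex.arg D < Real.pi := Complex.arg_lt_pi_iff.mpr (Or.inl hDre.le)
    have harg2 : -Real.pi < Complex.arg D := Complex.neg_pi_lt_arg D
    have h2 : (2 : ℂ)⁻¹ = ((2⁻¹ : ℝ) : ℂ) := by push_cast; rfl
    have him : (Complex.log D * (2 : ℂ)⁻¹).im = Complex.arg D / 2 := by
      rw [h2, Complex.mul_im, Complex.ofReal_re, Complex.ofReal_im, mul_zero, zero_add,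
        Complex.log_im]
      ring
    rw [him, Set.mem_Ioo]
    constructor <;> linarith
  refine ⟨hslit, hsq, hwre, ?_⟩
  -- `w - 1 = η / (w + 1)`, `‖w + 1‖ ≥ 1`
  have hw1 : w + 1 ≠ 0 := by
    intro h
    have : (w + 1).re = 0 := by rw [h, Complex.zero_re]
    rw [Complex.add_re, Complex.one_re] at this
    linarith
  have hkey : w - 1 = η / (w + 1) := by
    rw [eq_div_iff hw1]
    have : (w - 1) * (w + 1) = w ^ 2 - 1 := by ring
    rw [this, hsq, hD]; ring
  have hnorm1 : 1 ≤ ‖w + 1‖ := by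
    have h := Complex.abs_re_le_norm (w + 1)
    rw [Complex.add_re, Complex.one_re] at h
    have : |w.re + 1| = w.re + 1 := abs_of_pos (by linarith)
    linarith
  rw [hkey, norm_div]
  exact div_le_self (norm_nonneg _) hnorm1

/-- **The escaping direction.**  For `α ≠ 0` and `e ≥ 1` there are a sign `q = ±1` and `μ` with
`μ² = -8π e α q i` and `Re(μ / (2eα)) > 0`: the two candidates `±8π e α i` for `μ²` are negatives of
each other, so not both `μ/(2eα)` are purely imaginary. [folklore] -/
theorem exists_sign_sqrt {α : ℂ} (hα : α ≠ 0) {e : ℕ} (he : 0 < e) :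
    ∃ (q : ℤ) (μ : ℂ), (q = 1 ∨ q = -1) ∧
      μ ^ 2 = -(8 * Real.pi * e * α * q * I) ∧ 0 < (μ / (2 * e * α)).re := by
  set M : ℂ := -(8 * Real.pi * e * α * I) with hM
  have hpi : (Real.pi : ℂ) ≠ 0 := Complex.ofReal_ne_zero.2 Real.pi_ne_zero
  have he0 : (e : ℂ) ≠ 0 := by exact_mod_cast he.ne'
  have hM0 : M ≠ 0 := by
    rw [hM, neg_ne_zero]
    exact mul_ne_zero (mul_ne_zero (mul_ne_zero (mul_ne_zero (by norm_num) hpi) he0) hα) Complex.I_ne_zero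
  set μ₁ : ℂ := M ^ ((2 : ℂ)⁻¹) with hμ₁
  have hsq : μ₁ ^ 2 = M := by
    have h := Complex.cpow_nat_inv_pow M (n := 2) two_ne_zero
    simp only [Nat.cast_ofNat] at h
    exact h
  have hμ0 : μ₁ ≠ 0 := by
    intro h; rw [h, zero_pow two_ne_zero] at hsq; exact hM0 hsq.symm
  have h2eα : (2 * (e : ℂ) * α) ≠ 0 := mul_ne_zero (mul_ne_zero two_ne_zero he0) hα
  set t : ℂ := μ₁ / (2 * e * α) with ht
  have ht0 : t ≠ 0 := div_ne_zero hμ0 h2eα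
  rcases lt_trichotomy 0 t.re with hpos | hzero | hneg
  · exact ⟨1, μ₁, Or.inl rfl, by rw [hsq, hM]; push_cast; ring, hpos⟩
  · -- `t` purely imaginary: rotate by `i` (changes the sign `q`)
    have htim : t.im ≠ 0 := by
      intro h
      apply ht0
      apply Complex.ext <;> simp [← hzero, h]
    rcases lt_or_gt_of_ne htim with hlt | hgt
    · refine ⟨-1, I * μ₁, Or.inr rfl, ?_, ?_⟩
      · rw [mul_pow, Complex.I_sq, hsq, hM]; push_cast; ring
      · have : I * μ₁ / (2 * e * α) = I * t := by rw [ht]; ring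
        rw [this, Complex.mul_re, Complex.I_re, Complex.I_im, zero_mul, one_mul, zero_sub]
        linarith
    · refine ⟨-1, -(I * μ₁), Or.inr rfl, ?_, ?_⟩
      · rw [neg_sq, mul_pow, Complex.I_sq, hsq, hM]; push_cast; ring
      · have : -(I * μ₁) / (2 * e * α) = -(I * t) := by rw [ht]; ring
        rw [this, Complex.neg_re, Complex.mul_re, Complex.I_re, Complex.I_im, zero_mul, one_mul,
          zero_sub, neg_neg]
        exact hgt
  · refine ⟨1, -μ₁, Or.inl rfl, by rw [neg_sq, hsq, hM]; push_cast; ring, ?_⟩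
    have : -μ₁ / (2 * e * α) = -t := by rw [ht]; ring
    rw [this, Complex.neg_re]
    linarith

/-- `(√k)^d · e^{-(ρ √k - C)} → 0` for `ρ > 0`. [folklore] -/
theorem tendsto_sqrt_pow_mul_exp_neg (d : ℕ) {ρ : ℝ} (hρ : 0 < ρ) (C : ℝ) :
    Tendsto (fun k : ℕ => Real.sqrt k ^ d * Real.exp (-(ρ * Real.sqrt k - C))) atTop (𝓝 0) := by
  have h1 : Tendsto (fun k : ℕ => ρ * Real.sqrt k) atTop atTop :=
    (Real.tendsto_sqrt_atTop.comp tendsto_natCast_atTop_atTop).const_mul_atTop hρ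
  have h2 := ((Real.tendsto_pow_mul_exp_neg_atTop_nhds_zero d).comp h1).const_mul (Real.exp C / ρ ^ d)
  rw [mul_zero] at h2
  refine h2.congr fun k => ?_
  simp only [Function.comp]
  rw [mul_pow, neg_sub, Real.exp_sub, show Real.exp C / Real.exp (ρ * Real.sqrt k) =
    Real.exp C * Real.exp (-(ρ * Real.sqrt k)) by rw [Real.exp_neg, div_eq_mul_inv]]
  field_simp

/-- The split `t^{e-1} ≤ t^e / T + T^{e-1}` for `t ≥ 0`, `T > 0`, `e ≥ 1`. [folklore] -/
theorem pow_pred_le_div_add {t T : ℝ} (ht : 0 ≤ t) (hT : 0 < T) {e : ℕ} (he : 0 < e) :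
    t ^ (e - 1) ≤ t ^ e / T + T ^ (e - 1) := by
  obtain ⟨f, rfl⟩ : ∃ f, e = f + 1 := ⟨e - 1, by omega⟩
  rw [Nat.add_sub_cancel]
  rcases le_or_gt t T with h | h
  · have : t ^ f ≤ T ^ f := pow_le_pow_left₀ ht h f
    have : 0 ≤ t ^ (f + 1) / T := by positivity
    linarith
  · have h1 : t ^ f ≤ t ^ (f + 1) / T := by
      rw [le_div_iff₀ hT, pow_succ]
      exact mul_le_mul_of_nonneg_left h.le (pow_nonneg ht _)
    have : 0 ≤ T ^ f := by positivity
    linarith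

/-- **Pointwise bound for the perturbation** `g = (A(z) + u F̃(u)) e^{ζ - z}` when
`lc(F) u^{e} = e^{z - ζ}` (`e = 1 + deg F`, `F̃ = eraseLead F`), `‖ζ‖ < 1`, `T > 0`:
`‖g‖ ≤ (B_A max(1,‖z‖)^{deg A} + (B̃ + 1)(1/T + T^{deg F})) e^{1 - Re z} + (B̃ + 1) e² / (|lc F| T)`
(`B_A`, `B̃` the coefficient sums).  The `u`-term uses the Young split `t^{e-1} ≤ t^e/T + T^{e-1}`
and `‖u‖^e |lc F| = e^{Re z - Re ζ}`. [folklore] -/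
theorem expExp_perturbation_bound (A : Polynomial ℂ) {F : Polynomial ℂ} (hF : F ≠ 0) {T : ℝ}
    (hT : 0 < T) (z ζ u : ℂ) (hζ : ‖ζ‖ < 1)
    (hcue : F.leadingCoeff * u ^ (F.natDegree + 1) = exp (z - ζ)) :
    ‖(A.eval z + u * F.eraseLead.eval u) * exp (ζ - z)‖ ≤
      ((∑ i ∈ Finset.range (A.natDegree + 1), ‖A.coeff i‖) * max 1 ‖z‖ ^ A.natDegree +
        ((∑ i ∈ Finset.range (F.eraseLead.natDegree + 1), ‖F.eraseLead.coeff i‖) + 1) *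
          (1 / T + T ^ F.natDegree)) * Real.exp (1 - z.re) +
      ((∑ i ∈ Finset.range (F.eraseLead.natDegree + 1), ‖F.eraseLead.coeff i‖) + 1) * Real.exp 2 /
        (‖F.leadingCoeff‖ * T) := by
  set e : ℕ := F.natDegree + 1 with he
  have hepos : 0 < e := by positivity
  set c : ℂ := F.leadingCoeff with hcdef
  have hc0 : c ≠ 0 := Polynomial.leadingCoeff_ne_zero.2 hF
  have hcpos : 0 < ‖c‖ := norm_pos_iff.2 hc0
  set Fe : Polynomial ℂ := F.eraseLead with hFe
  set BA : ℝ := ∑ i ∈ Finset.range (A.natDegree + 1), ‖A.coeff i‖ with hBA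
  have hBA0 : 0 ≤ BA := Finset.sum_nonneg fun _ _ => norm_nonneg _
  set Be : ℝ := ∑ i ∈ Finset.range (Fe.natDegree + 1), ‖Fe.coeff i‖ with hBe
  have hBe0 : 0 ≤ Be := Finset.sum_nonneg fun _ _ => norm_nonneg _
  have hue_norm : ‖u‖ ^ e = Real.exp (z.re - ζ.re) / ‖c‖ := by
    have h := congrArg norm hcue
    rw [norm_mul, norm_pow, Complex.norm_exp (z - ζ), Complex.sub_re] at h
    rw [eq_div_iff hcpos.ne', mul_comm]
    exact h
  have hζre : ζ.re ≤ 1 := (abs_le.1 ((Complex.abs_re_le_norm ζ).trans hζ.le)).2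
  have hζre' : -1 ≤ ζ.re := (abs_le.1 ((Complex.abs_re_le_norm ζ).trans hζ.le)).1
  have hexp : ‖exp (ζ - z)‖ ≤ Real.exp (1 - z.re) := by
    rw [Complex.norm_exp, Complex.sub_re]; exact Real.exp_le_exp.2 (by linarith)
  have hAz : ‖A.eval z‖ ≤ BA * max 1 ‖z‖ ^ A.natDegree :=
    Literature.ModelTheory.Zilber.norm_eval_le_sum_mul_pow A z
  have huFe : ‖u * Fe.eval u‖ ≤ (Be + 1) * ((1 + Real.exp (z.re - ζ.re) / ‖c‖) / T + T ^ (e - 1)) := by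
    by_cases hFe0 : Fe = 0
    · rw [hFe0, Polynomial.eval_zero, mul_zero, norm_zero]; positivity
    · have hf1 : 1 ≤ F.natDegree := by
        by_contra h
        push Not at h
        have h0 : F.natDegree = 0 := by omega
        apply hFe0
        rw [hFe, Polynomial.eq_C_of_natDegree_eq_zero h0, Polynomial.eraseLead_C]
      have hdegFe : 1 + Fe.natDegree ≤ e - 1 := by
        have := Polynomial.eraseLead_natDegree_le F
        rw [← hFe] at this; omega
      set t : ℝ := max 1 ‖u‖ with ht
      have ht1 : 1 ≤ t := le_max_left _ _
      have ht0 : 0 ≤ t := zero_le_one.trans ht1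
      have h1 : ‖u * Fe.eval u‖ ≤ Be * t ^ (1 + Fe.natDegree) := by
        rw [norm_mul, pow_add, pow_one]
        calc ‖u‖ * ‖Fe.eval u‖ ≤ t * (Be * t ^ Fe.natDegree) :=
              mul_le_mul (le_max_right _ _) (Literature.ModelTheory.Zilber.norm_eval_le_sum_mul_pow Fe u)
                (norm_nonneg _) ht0
          _ = Be * (t * t ^ Fe.natDegree) := by ring
      have h2 : t ^ (1 + Fe.natDegree) ≤ t ^ (e - 1) := pow_le_pow_right₀ ht1 hdegFe
      have h3 : t ^ (e - 1) ≤ t ^ e / T + T ^ (e - 1) := pow_pred_le_div_add ht0 hT hepos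
      have h4 : t ^ e ≤ 1 + ‖u‖ ^ e := by
        rcases le_total 1 ‖u‖ with h | h
        · rw [ht, max_eq_right h]; linarith
        · rw [ht, max_eq_left h, one_pow]; linarith [pow_nonneg (norm_nonneg u) e]
      rw [hue_norm] at h4
      calc ‖u * Fe.eval u‖ ≤ Be * t ^ (1 + Fe.natDegree) := h1
        _ ≤ Be * t ^ (e - 1) := mul_le_mul_of_nonneg_left h2 hBe0
        _ ≤ (Be + 1) * t ^ (e - 1) := mul_le_mul_of_nonneg_right (by linarith) (pow_nonneg ht0 _)
        _ ≤ (Be + 1) * (t ^ e / T + T ^ (e - 1)) := mul_le_mul_of_nonneg_left h3 (by positivity)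
        _ ≤ (Be + 1) * ((1 + Real.exp (z.re - ζ.re) / ‖c‖) / T + T ^ (e - 1)) := by gcongr
  have he1 : e - 1 = F.natDegree := by rw [he]; omega
  rw [he1] at huFe
  -- assemble
  have hXE : Real.exp (z.re - ζ.re) * Real.exp (1 - z.re) = Real.exp (1 - ζ.re) := by
    rw [← Real.exp_add]; ring_nf
  have hlast : (Be + 1) / (‖c‖ * T) * Real.exp (1 - ζ.re) ≤ (Be + 1) * Real.exp 2 / (‖c‖ * T) := by
    rw [div_mul_eq_mul_div]
    gcongr
    linarith
  rw [norm_mul]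
  calc ‖A.eval z + u * Fe.eval u‖ * ‖exp (ζ - z)‖
      ≤ (‖A.eval z‖ + ‖u * Fe.eval u‖) * Real.exp (1 - z.re) :=
        mul_le_mul (norm_add_le _ _) hexp (norm_nonneg _) (by positivity)
    _ ≤ (BA * max 1 ‖z‖ ^ A.natDegree +
          (Be + 1) * ((1 + Real.exp (z.re - ζ.re) / ‖c‖) / T + T ^ F.natDegree)) * Real.exp (1 - z.re) := by
        gcongr
    _ = (BA * max 1 ‖z‖ ^ A.natDegree + (Be + 1) * (1 / T + T ^ F.natDegree)) * Real.exp (1 - z.re) +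
          (Be + 1) / (‖c‖ * T) * (Real.exp (z.re - ζ.re) * Real.exp (1 - z.re)) := by ring
    _ ≤ _ := by rw [hXE]; gcongr

end Summit.Schanuel.Schanuel.Theorems

end
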